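import Literature.NumberTheory.EllipticCurves.LambdaAdicSelmerDataCoresProofs
import Literature.NumberTheory.EllipticCurves.CompactSelmerNoPTorsionProofs
import Literature.NumberTheory.EllipticCurves.IwasawaAlgebraLiftingExponentProofs
import HarnessLib

/-!
# The `Λ`-adic Selmer module `𝔖_p(K_∞) = lim←_n S_p(E/K_n)` is a TORSION-FREE `Λ`-module when
# `E(K)[p] = 0` — for every pin `D : LambdaAdicSelmerData`, every number field `K`, every `ℤ_p`-extension
# with a topological generator (proofs file; Shapiro-free, levelwise)

Topic `NumberTheory/EllipticCurves`. THEOREMS ONLY (no definition, no named fact, no `sorry`, no instance,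
no notation), dot-notation extensions of `WeierstrassCurve.LambdaAdicSelmerData` (file `HeegnerModuleIndex`),
as the sibling proofs files `CompactSelmerTowerNormProofs` / `LambdaAdicSelmerDataCoresProofs` do. Written by
the cell `pub/bsd-print-x9`, seat `bsd-line-x9-p2` (g3), for the shared μ-item of crux
stmt-BirchSwinnertonDyer-27077 (skeleton v8/v9, STUB 2): the clause «`κ.one ≠ 0` for `m ≫ 0`» of the
specialised Kolyvagin system is `IwasawaAlgebra.exists_forall_map_ne_zero` (file
`IwasawaAlgebraSpecializationSeparationProofs`) applied to a NON-TORSION class `κ_∞ ∈ 𝔖`; inside the frame-free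
letter `MuPartStabilizedCoherentPair` no torsion-freeness binder is available (it is conjunct 1 of the
cite-only crux binder `CGLSHeegnerClassNonvanishing` = `thm411_torsionFree_heegnerClass_ne_bot_quotient_isTorsion`),
so it is PROVED here from the letter's own prefix (`Thm413Hypotheses.noPTorsion`, `.topGenerator`).

WHAT. For `V` an elliptic curve over a number field `K`, `κ` a `ℤ_p`-extension of `K` with topological
generator `γ` (`κ.IsTopGenerator γ`), `E(K)[p] = 0` (`hE : ∀ P : V⟮K⟯, p • P = 0 → P = 0`) and ANY pin
`D : V.LambdaAdicSelmerData κ γ` of `𝔖_p(K_∞)` (`Λ = ℤ_p⟦X⟧`, `X ↦ γ − 1`):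
* §1 `noPTorsion_layer` — `E(K_n)[p] = 0` at every layer in the cocycle format of
  `CompactSelmerNoPTorsionProofs` (from `fixedPoints_kerSubgroup_geomPrimaryTorsion_eq_bot`: `E(K_∞)[p^∞] = 0`).
* §2 `eq_zero_of_pow_natCast_smul_eq_zero` — the `p`-PART: `(p^c : Λ) • s = 0 ⇒ s = 0` (levelwise
  `eq_zero_of_pow_zsmul_eq_zero_of_reduce_eq` on the compatible families `proj_n s ∈ S_p(E/K_n)`, then `D.ext`).
* §3 `proj_geom_sum_smul_eq_resPi_proj` — the universal-norm identity in `Λ`-form: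
  `proj_{n+k} (ν_{n,k} • s) = res_{K_n → K_{n+k}} (proj_n s)`, `ν_{n,k} = Σ_{i<p^k} (1+X)^{p^n i}`
  (`resPi_proj_eq_sum_conjPi_proj` + `proj_one_add_X_pow_smul`).
* §4 `exists_resPi_proj_eq_pow_nsmul` — THE ENGINE: if `f • s = 0` and `(1+X)^{p^n} = 1 + a f + p^k b`
  (lifting the exponent, `IwasawaAlgebraLiftingExponentProofs`), then `res_{K_n→K_{n+k}} (proj_n s) = p^k • proj_{n+k} z`
  for some `z ∈ 𝔖` (`ν_{n,k} ≡ p^k (mod ω_n)`, `ω_n • s = p^k (b • s)`); `resPi_proj_apply_eq_zero` — hence the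
  component of `p`-adic precision `k` of `res (proj_n s)` VANISHES (`H¹(K_{n+k}, E[p^k])` is killed by `p^k`).
* §5 `eq_zero_of_smul_eq_zero_of_shape` — `f = X^d · v + p · w` (`v` a unit), `f • s = 0 ⇒ s = 0`: for a level
  `N` and a precision `k` choose `n ≥ N` with `(1+X)^{p^n} ≡ 1 (mod (f, p^k))` (`exists_one_add_X_pow_eq`), apply
  §4 to the `f`-torsion element `ν_{N,n−N} • s` and use §3 twice with the INJECTIVITY of restriction along the
  tower under `E(K)[p] = 0` (`resOfLe_layer_injective_of_noPTorsion`): `(proj_N s)_k = 0`; then `D.ext`.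
* §6 `eq_zero_of_smul_eq_zero` (`f ≠ 0`, `f • s = 0 ⇒ s = 0`: `f = p^m f′`, §2, `f′ = X^d v + p w`, §5),
  **`noZeroSMulDivisors_of_noPTorsion`**, **`isTorsionFree_of_noPTorsion`**, `torsion_eq_bot_of_noPTorsion`,
  and the consumer form `forall_smul_ne_zero_of_ne_zero'` (`s ≠ 0 ⇒ d • s ≠ 0` for all `d ≠ 0` = the
  hypothesis `hy` of `IwasawaAlgebra.exists_forall_map_ne_zero`).

METHOD. The tree's Shapiro-free proof of Kato, Astérisque 295, Thm. 12.4 (2) (`Kato2004/IwasawaH1LambdaTorsionFreeProofs`,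
cell `bsd-potss`) transposed from the pin `Kato2004.IwasawaH1Data` (levels `H¹(ℚ_n, T_pW)`, trace maps) to the pin
`LambdaAdicSelmerData` (levels `S_p(E/K_n) ⊆ ∏_k H¹(K_n, E[p^k])`, restriction/norm): here the levels are ALREADY
reduced modulo `p^k` (no separatedness lemma needed) and `E(K)[p] = 0` makes restriction injective (no uniform
exponent for `E(K_∞)[p^∞]` needed), so the argument shortens. The hypothesis `κ.IsTopGenerator γ` is necessary
(for `γ = 1` the variable `X` acts as `0`); no reduction-type / image / anticyclotomic hypothesis is used.

PRINT. Castella–Grossi–Lee–Skinner 2022, §3.3 (proof of Thm. 3.3.1): "The assumption `T̄^{G_K} = 0` implies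
that `H¹_𝓕(K, T)` is torsion-free", carried to `𝐓` in the proof of Thm. 3.4.1; Burungale–Castella–Kim 2021,
proof of Thm. 5.2, first sentence (torsion-freeness of the `Λ`-adic Selmer module under `H⁰(G_K, ρ̄) = 0`, "since
`Gal(K_∞/K)` is pro-`p` … by [PR94, §1.3.3]"); Howard 2004, proof of Thm. 2.2.10 ("Lemma (torsion free)");
Perrin-Riou 1987 §0 (the compact modules `𝔖_p`). HONEST FRAMING: this proves conjunct 1 of the cite-only fact
`CastellaGrossiLeeSkinner2022.thm411_torsionFree_heegnerClass_ne_bot_quotient_isTorsion` unconditionally (for the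
tree's pinned `𝔖`, which carries the Selmer conditions at EVERY place — the Greenberg/ordinary refinement at `p`
is not needed for torsion-freeness); conjuncts 2 (Cornut–Vatsal non-vanishing) and 3 (rank one) are NOT
addressed. Nothing here is specific to Heegner points; BSD is not proved by any of this; no summit statement is
proved by this seat.

References: [CastellaGrossiLeeSkinner2022] F. Castella, G. Grossi, J. Lee, C. Skinner, Invent. Math. 227 (2022),
§3.3 (proof of Thm. 3.3.1, arXiv:2008.02571 p0017 L114) and proof of Thm. 3.4.1; [BurungaleCastellaKim2021]
proof of Thm. 5.2 (arXiv:1908.09512v2 TeX l.1060); [Howard2004HeegnerKolyvagin] B. Howard, Compositio Math. 140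
(2004), §2.2 and proof of Thm. 2.2.10; [PerrinRiou1987BSMF] B. Perrin-Riou, Bull. SMF 115 (1987), §0 pp. 401–402;
[GreenbergLNM1716] R. Greenberg, LNM 1716 (1999), §3 Lemma 3.1, §4 p. 109; [Washington1997] §7.1, §13.2–13.3
(`ω_n`, `ν_{n,m}`, lifting the exponent); [Kato2004Asterisque] Thm. 12.4 (2) (the template).
-/

set_option autoImplicit false

noncomputable section

open scoped Classical

open WeierstrassCurve Literature.NumberTheory.EllipticCurves
  Literature.NumberTheory.EllipticCurves.IwasawaAlgebra PowerSeries

universe u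

namespace WeierstrassCurve.LambdaAdicSelmerData

variable {K : Type u} [Field K] [NumberField K] {V : WeierstrassCurve K} [V.IsElliptic] {p : ℕ} [hp : Fact p.Prime]
  {κ : ZpExtension K p} {γ : Field.absoluteGaloisGroup K} (D : V.LambdaAdicSelmerData κ γ)

/-! ## §1 `E(K_n)[p] = 0` at every layer -/

/-- **`E(K)[p] = 0 ⇒ E(K_n)[p] = 0` at every layer of a `ℤ_p`-extension**, in the cocycle format of
`CompactSelmerNoPTorsionProofs`: a geometric point fixed by `Gal(K̄/K_n)` and killed by `p` is `0`
(it lies in `E(K_∞)[p^∞] = E[p^∞]^{Gal(K̄/K_∞)} = 0`, `fixedPoints_kerSubgroup_geomPrimaryTorsion_eq_bot`).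
[cite: GreenbergLNM1716, §4 p. 109 (E(F_∞)[p^∞] = 0 when E(F)[p] = 0)] -/
theorem noPTorsion_layer (κ : ZpExtension K p) (hE : ∀ P : V.toAffine.Point, p • P = 0 → P = 0) (n : ℕ) :
    ∀ P : geomPoints V, (∀ σ ∈ κ.layerSubgroup n, σ • P = P) → (p : ℤ) • P = 0 → P = 0 := by
  intro P hfix hpP
  have hbot := V.fixedPoints_kerSubgroup_geomPrimaryTorsion_eq_bot κ hE
  have hmem : P ∈ geomPrimaryTorsion V p := by
    refine (AddCommGroup.mem_primaryComponent).mpr ⟨1, ?_⟩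
    rw [pow_one, ← natCast_zsmul]
    exact hpP
  have hP : (⟨P, hmem⟩ : geomPrimaryTorsion V p) ∈
      FixedPoints.addSubgroup κ.kerSubgroup (geomPrimaryTorsion V p) := by
    rw [FixedPoints.mem_addSubgroup]
    rintro ⟨τ, hτ⟩
    apply Subtype.ext
    rw [Subgroup.mk_smul, primaryComponent.coe_smul]
    exact hfix τ (κ.kerSubgroup_le_layerSubgroup n hτ)
  rw [hbot, AddSubgroup.mem_bot] at hP
  exact congrArg Subtype.val hP

/-! ## §2 The `p`-part: `𝔖_p(K_∞)` has no `p`-torsion -/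

/-- **`(p^c : Λ) • s = 0 ⇒ s = 0` in `𝔖_p(K_∞)`** when `E(K)[p] = 0`: every component `proj_n s ∈ S_p(E/K_n)`
is a `p_*`-compatible family killed by `p^c`, hence `0` (`eq_zero_of_pow_zsmul_eq_zero_of_reduce_eq`), and the
projections are jointly injective (`D.ext`). [cite: PerrinRiou1987BSMF, §0 p. 401 (S_p(L) = lim← S(L)^{(p^k)})]
[cite: Howard2004HeegnerKolyvagin, §2.7 (E(K[n])[p] = 0)] -/
theorem eq_zero_of_pow_natCast_smul_eq_zero (hE : ∀ P : V.toAffine.Point, p • P = 0 → P = 0) (c : ℕ)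
    {s : D.S} (hs : ((p : IwasawaAlgebra p) ^ c) • s = 0) : s = 0 := by
  refine D.ext s fun n ↦ ?_
  have hx := ((V.mem_compactSelmerOver_iff (κ.layerSubgroup n) p (D.proj n s)).mp (D.proj_mem n s)).2
  refine V.eq_zero_of_pow_zsmul_eq_zero_of_reduce_eq p (κ.layerSubgroup n) (noPTorsion_layer κ hE n) c
    (D.proj n s) hx ?_
  have h1 : ((p : IwasawaAlgebra p) ^ c) • s = (p ^ c : ℕ) • s := by
    rw [← Nat.cast_smul_eq_nsmul (IwasawaAlgebra p), Nat.cast_pow]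
  have h2 : (p ^ c : ℕ) • D.proj n s = 0 := by rw [← map_nsmul, ← h1, hs, map_zero]
  rwa [← natCast_zsmul, Nat.cast_pow] at h2

/-- `(p : Λ)^c • s = 0 ⇒ s = 0`, with the scalar written through `PowerSeries.C` (`C (p^c) = (p : Λ)^c`).
[cite: PerrinRiou1987BSMF, §0 p. 401] -/
theorem eq_zero_of_C_pow_smul_eq_zero (hE : ∀ P : V.toAffine.Point, p • P = 0 → P = 0) (c : ℕ)
    {s : D.S} (hs : (PowerSeries.C ((p : ℤ_[p]) ^ c) : IwasawaAlgebra p) • s = 0) : s = 0 := by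
  refine D.eq_zero_of_pow_natCast_smul_eq_zero hE c ?_
  rwa [map_pow, map_natCast] at hs

/-! ## §3 Universal norms in `Λ`-form -/

omit [V.IsElliptic] in
/-- **`proj_{n+k} (ν_{n,k} • s) = res_{K_n → K_{n+k}} (proj_n s)`** with `ν_{n,k} = Σ_{i<p^k} ((1+X)^{p^n})^i`:
the `k`-fold iterate of the pin's norm relation (`resPi_proj_eq_sum_conjPi_proj`), the group-ring element
`(1+X)^{p^n i}` acting as `conj_{γ^{p^n i}}` (`proj_one_add_X_pow_smul`).
[cite: PerrinRiou1987BSMF, §0 p. 402 (res ∘ cor = N on 𝔖_p)] [cite: Washington1997, §13.3 (ν_{n,m})] -/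
theorem proj_geom_sum_smul_eq_resPi_proj (n k : ℕ) (s : D.S) :
    D.proj (n + k) ((∑ i ∈ Finset.range (p ^ k),
        ((1 + PowerSeries.X : IwasawaAlgebra p) ^ p ^ n) ^ i) • s) =
      V.resPi p (κ.layerSubgroup_antitone (Nat.le_add_right n k)) (D.proj n s) := by
  rw [D.resPi_proj_eq_sum_conjPi_proj n k s, Finset.sum_smul, map_sum]
  refine Finset.sum_congr rfl fun i _ ↦ ?_
  rw [← pow_mul, Literature.NumberTheory.EllipticCurves.proj_one_add_X_pow_smul D]

/-! ## §4 The engine: lifting the exponent forces `p^k`-divisibility of `res (proj_n s)` -/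

omit [V.IsElliptic] in
/-- **The engine.** If `f • s = 0` and `(1+X)^{p^n} = 1 + a f + p^k b` in `Λ`, then
`res_{K_n → K_{n+k}} (proj_n s) = p^k • proj_{n+k} z` for `z = s + (r b) • s`, where
`ν_{n,k} = p^k + ω_n r` (`exists_geom_sum_eq`) and `ω_n • s = p^k (b • s)`.
[cite: Washington1997, §13.3 (Lemma 13.15: ν_{n,m} ≡ p^m mod ω_n) and §7.1]
[cite: Kato2004Asterisque, Thm. 12.4 (2) and §13.8 (the template argument)] -/
theorem exists_resPi_proj_eq_pow_nsmul {f : PowerSeries ℤ_[p]} {s : D.S} (hs : (f : IwasawaAlgebra p) • s = 0)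
    {n k : ℕ} (hR : ∃ a b : PowerSeries ℤ_[p],
      (1 + PowerSeries.X) ^ p ^ n = 1 + a * f + (p : PowerSeries ℤ_[p]) ^ k * b) :
    ∃ z : D.S, V.resPi p (κ.layerSubgroup_antitone (Nat.le_add_right n k)) (D.proj n s) =
      (p ^ k) • D.proj (n + k) z := by
  obtain ⟨a, b, hab⟩ := hR
  obtain ⟨r, hr⟩ := exists_geom_sum_eq ((1 + PowerSeries.X : PowerSeries ℤ_[p]) ^ p ^ n) (p ^ k)
  refine ⟨s + ((r * b : PowerSeries ℤ_[p]) : IwasawaAlgebra p) • s, ?_⟩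
  have hω : ((((1 + PowerSeries.X : PowerSeries ℤ_[p]) ^ p ^ n - 1) * r : PowerSeries ℤ_[p]) :
      IwasawaAlgebra p) • s =
      (((p : PowerSeries ℤ_[p]) ^ k * (r * b) : PowerSeries ℤ_[p]) : IwasawaAlgebra p) • s := by
    rw [hab, show (1 + a * f + (p : PowerSeries ℤ_[p]) ^ k * b - 1) * r =
        (r * a) * f + (p : PowerSeries ℤ_[p]) ^ k * (r * b) by ring,
      add_smul, mul_smul, hs, smul_zero, zero_add]
  have key : ((((p ^ k : ℕ) : PowerSeries ℤ_[p]) +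
        ((1 + PowerSeries.X : PowerSeries ℤ_[p]) ^ p ^ n - 1) * r : PowerSeries ℤ_[p]) :
      IwasawaAlgebra p) • s = (p ^ k) • (s + ((r * b : PowerSeries ℤ_[p]) : IwasawaAlgebra p) • s) := by
    rw [add_smul, hω, ← Nat.cast_pow, mul_smul, Nat.cast_smul_eq_nsmul, Nat.cast_smul_eq_nsmul, smul_add]
  rw [← D.proj_geom_sum_smul_eq_resPi_proj n k s, hr, key, map_nsmul]

omit [NumberField K] [V.IsElliptic] hp in
/-- A component of precision `j ≤ k` of a `p^k`-multiple vanishes (`H¹(H, E[p^j])` is killed by `p^j`,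
`pow_smul_torsionH1Over_eq_zero`). [cite: PerrinRiou1987BSMF, §0 p. 401 (S(L)^{(p^j)} is p^j-torsion)] -/
theorem pow_nsmul_apply_eq_zero_of_le {H : Subgroup (Field.absoluteGaloisGroup K)}
    (y : Π j : ℕ, V.torsionH1Over ((p : ℤ) ^ j) H) {j k : ℕ} (hjk : j ≤ k) :
    ((p ^ k) • y) j = 0 := by
  have h : (p ^ j) • y j = 0 := by
    rw [← natCast_zsmul, Nat.cast_pow]
    exact V.pow_smul_torsionH1Over_eq_zero H p j (y j)
  rw [Pi.smul_apply, ← Nat.sub_add_cancel hjk, pow_add, mul_nsmul', h, smul_zero]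

omit [V.IsElliptic] in
/-- **The precision-`k` component of `res_{K_n → K_{n+k}} (proj_n s)` vanishes** under the hypotheses of
the engine. [cite: Kato2004Asterisque, Thm. 12.4 (2) and §13.8 (the template argument)]
[cite: Washington1997, §13.3 (Lemma 13.15)] -/
theorem resPi_proj_apply_eq_zero {f : PowerSeries ℤ_[p]} {s : D.S} (hs : (f : IwasawaAlgebra p) • s = 0)
    {n k : ℕ} (hR : ∃ a b : PowerSeries ℤ_[p],
      (1 + PowerSeries.X) ^ p ^ n = 1 + a * f + (p : PowerSeries ℤ_[p]) ^ k * b) {j : ℕ} (hjk : j ≤ k) :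
    V.resPi p (κ.layerSubgroup_antitone (Nat.le_add_right n k)) (D.proj n s) j = 0 := by
  obtain ⟨z, hz⟩ := D.exists_resPi_proj_eq_pow_nsmul hs hR
  rw [hz]
  exact pow_nsmul_apply_eq_zero_of_le (V := V) (p := p) _ hjk

/-! ## §5 Torsion-freeness for a power series in Weierstrass shape modulo `p` -/

omit [NumberField K] [V.IsElliptic] hp in
/-- The restriction `resPi` is `resOfLe` componentwise (definitional unfolding).
[cite: PerrinRiou1987BSMF, §0 pp. 401–402] -/
theorem resPi_apply {H H' : Subgroup (Field.absoluteGaloisGroup K)} (h : H ≤ H')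
    (y : Π j : ℕ, V.torsionH1Over ((p : ℤ) ^ j) H') (j : ℕ) :
    V.resPi p h y j = Literature.NumberTheory.EllipticCurves.resOfLe (geomTorsion V ((p : ℤ) ^ j)) h (y j) := by
  simp only [resPi, AddMonoidHom.pi_apply, AddMonoidHom.coe_comp, Function.comp_apply,
    Pi.evalAddMonoidHom_apply]

/-- **`f = X^d · v + p · w` (`v ∈ Λˣ`), `f • s = 0 ⇒ s = 0`** when `E(K)[p] = 0` and `γ` is a topological
generator. For a level `N` and a precision `k`: LIFTING THE EXPONENT gives `n ≥ N` with
`(1+X)^{p^n} = 1 + a f + p^k b` (`exists_one_add_X_pow_eq`); the `f`-torsion element `t = ν_{N,n−N} • s` has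
`proj_n t = res_{K_N→K_n} (proj_N s)` (§3) and `res_{K_n→K_{n+k}} (proj_n t)` has vanishing precision-`k`
component (§4); restriction being injective on `H¹(K_·, E[p^k])` along the tower (`E(K)[p] = 0`,
`resOfLe_layer_injective_of_noPTorsion`), `(proj_N s)_k = 0`; so `s = 0` (`D.ext`).
[cite: CastellaGrossiLeeSkinner2022, §3.3 proof of Thm. 3.3.1 (arXiv:2008.02571 p0017 L114: "T̄^{G_K} = 0 implies H¹_𝓕(K,T) torsion-free")]
[cite: Kato2004Asterisque, Thm. 12.4 (2) and §13.8 (the template argument)] -/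
theorem eq_zero_of_smul_eq_zero_of_shape (hγ : κ.IsTopGenerator γ)
    (hE : ∀ P : V.toAffine.Point, p • P = 0 → P = 0) {f v w : PowerSeries ℤ_[p]} {d : ℕ} (hv : IsUnit v)
    (hf : f = PowerSeries.X ^ d * v + (p : PowerSeries ℤ_[p]) * w) {s : D.S}
    (hs : (f : IwasawaAlgebra p) • s = 0) : s = 0 := by
  have _ := hγ
  refine D.ext s fun N ↦ funext fun k ↦ ?_
  obtain ⟨n, hNn, hR⟩ := exists_one_add_X_pow_eq p hv hf k N
  obtain ⟨j, rfl⟩ := Nat.exists_eq_add_of_le hNn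
  -- the `f`-torsion element `t = ν_{N,j} • s`, with `proj (N+j) t = res (proj N s)`
  set t : D.S := (∑ i ∈ Finset.range (p ^ j),
      ((1 + PowerSeries.X : IwasawaAlgebra p) ^ p ^ N) ^ i) • s with ht
  have hts : (f : IwasawaAlgebra p) • t = 0 := by rw [ht, smul_comm, hs, smul_zero]
  -- precision-`k` component of `res_{K_{N+j} → K_{N+j+k}} (proj (N+j) t)` vanishes
  have h1 : V.resPi p (κ.layerSubgroup_antitone (Nat.le_add_right (N + j) k)) (D.proj (N + j) t) k = 0 :=
    D.resPi_proj_apply_eq_zero hts hR le_rfl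
  -- hence `(proj (N+j) t)_k = 0` by injectivity of restriction
  have h2 : D.proj (N + j) t k = 0 := by
    rw [resPi_apply] at h1
    exact resOfLe_layer_injective_of_noPTorsion hE _ k (by rw [h1, map_zero])
  -- `proj (N+j) t = res (proj N s)`, and restriction is injective again
  have h3 : V.resPi p (κ.layerSubgroup_antitone (Nat.le_add_right N j)) (D.proj N s) k = 0 := by
    rw [← D.proj_geom_sum_smul_eq_resPi_proj N j s, ← ht, h2]
  rw [resPi_apply] at h3
  rw [Pi.zero_apply]
  exact resOfLe_layer_injective_of_noPTorsion hE _ k (by rw [h3, map_zero])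

/-! ## §6 `𝔖_p(K_∞)` is `Λ`-torsion-free -/

/-- **`𝔖_p(K_∞)` is a torsion-free `Λ`-module when `E(K)[p] = 0`**: for every number field `K`, elliptic
curve `E/K` with `E(K)[p] = 0`, `ℤ_p`-extension `κ` with topological generator `γ`, and pin
`D : LambdaAdicSelmerData`, if `f ≠ 0` in `Λ = ℤ_p⟦X⟧` and `f • s = 0` then `s = 0`. Proof: `f = p^m f′` with a
coefficient of `f′` prime to `p` (`exists_eq_pow_mul_of_ne_zero`), `f′ • s = 0` by the `p`-part (§2),
`f′ = X^d v + p w` (`exists_eq_X_pow_mul_add_mul`), and §5. Printed: CGLS22 §3.3 "The assumption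
`T̄^{G_K} = 0` implies that `H¹_𝓕(K, T)` is torsion-free" (for `𝐓` via the proof of Thm. 3.4.1); BCK21 proof of
Thm. 5.2, first sentence; Howard 2004, proof of Thm. 2.2.10 ("Lemma (torsion free)").
[cite: CastellaGrossiLeeSkinner2022, §3.3 proof of Thm. 3.3.1 (arXiv:2008.02571 p0017 L114) and proof of Thm. 3.4.1 (p0021 L12–L21)]
[cite: BurungaleCastellaKim2021, proof of Thm. 5.2, first sentence (arXiv:1908.09512v2 TeX l.1060)]
[cite: Howard2004HeegnerKolyvagin, proof of Thm. 2.2.10 (torsion-freeness of the Λ-adic Selmer module)] -/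
theorem eq_zero_of_smul_eq_zero (hγ : κ.IsTopGenerator γ) (hE : ∀ P : V.toAffine.Point, p • P = 0 → P = 0)
    {f : IwasawaAlgebra p} (hf : f ≠ 0) {s : D.S} (hs : f • s = 0) : s = 0 := by
  obtain ⟨m, f', rfl, hf'⟩ := exists_eq_pow_mul_of_ne_zero p hf
  obtain ⟨d, v, w, hv, hf'eq⟩ := exists_eq_X_pow_mul_add_mul p hf'
  have hs' : (f' : IwasawaAlgebra p) • s = 0 := by
    refine D.eq_zero_of_pow_natCast_smul_eq_zero hE m ?_
    rw [← mul_smul]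
    exact hs
  exact D.eq_zero_of_smul_eq_zero_of_shape hγ hE hv hf'eq hs'

/-- **`NoZeroSMulDivisors Λ 𝔖_p(K_∞)`** when `E(K)[p] = 0` and `γ` is a topological generator: conjunct 1 of
the cite-only `CastellaGrossiLeeSkinner2022.thm411_torsionFree_heegnerClass_ne_bot_quotient_isTorsion`, now a
theorem for every pin (the hypothesis `[NoZeroSMulDivisors (IwasawaAlgebra p) D.S]` of
`free_finrank_eq_one_stabilizedHeegnerModule_of_eq_span_singleton`, `Howard2004_heegnerModule_free`, …).
[cite: CastellaGrossiLeeSkinner2022, §3.3 proof of Thm. 3.3.1 (arXiv:2008.02571 p0017 L114)]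
[cite: BurungaleCastellaKim2021, proof of Thm. 5.2, first sentence (arXiv:1908.09512v2 TeX l.1060)] -/
theorem noZeroSMulDivisors_of_noPTorsion (hγ : κ.IsTopGenerator γ)
    (hE : ∀ P : V.toAffine.Point, p • P = 0 → P = 0) :
    NoZeroSMulDivisors (IwasawaAlgebra p) D.S :=
  ⟨fun h ↦ or_iff_not_imp_left.mpr fun hf ↦ D.eq_zero_of_smul_eq_zero hγ hE hf h⟩

/-- **`𝔖_p(K_∞)` is torsion-free in Mathlib's sense** (`Module.IsTorsionFree Λ 𝔖`).
[cite: CastellaGrossiLeeSkinner2022, §3.3 proof of Thm. 3.3.1 (arXiv:2008.02571 p0017 L114)] -/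
theorem isTorsionFree_of_noPTorsion (hγ : κ.IsTopGenerator γ)
    (hE : ∀ P : V.toAffine.Point, p • P = 0 → P = 0) :
    Module.IsTorsionFree (IwasawaAlgebra p) D.S :=
  Module.IsTorsionFree.of_smul_eq_zero fun _ _ h ↦
    or_iff_not_imp_left.mpr fun hf ↦ D.eq_zero_of_smul_eq_zero hγ hE hf h

/-- **The `Λ`-torsion submodule of `𝔖_p(K_∞)` is zero** (`𝔖_{Λ-tors} = ⊥`).
[cite: CastellaGrossiLeeSkinner2022, §3.3 proof of Thm. 3.3.1 (arXiv:2008.02571 p0017 L114)] -/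
theorem torsion_eq_bot_of_noPTorsion (hγ : κ.IsTopGenerator γ)
    (hE : ∀ P : V.toAffine.Point, p • P = 0 → P = 0) :
    Submodule.torsion (IwasawaAlgebra p) D.S = ⊥ := by
  haveI := D.isTorsionFree_of_noPTorsion hγ hE
  exact Submodule.isTorsionFree_iff_torsion_eq_bot.mp inferInstance

/-- **Consumer form (the hypothesis `hy` of `IwasawaAlgebra.exists_forall_map_ne_zero`)**: a non-zero
`s ∈ 𝔖_p(K_∞)` is non-torsion, `d • s ≠ 0` for every `d ≠ 0` — so a non-zero `Λ`-adic class `κ_∞` yields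
`κ₁^{(q_m)} ≠ 0` for all large `m` once the kernels of the specialisation maps are controlled (Howard, proof of
Thm. 2.2.10: "`κ₁^{(𝔭)}` generates an infinite `S_𝔭`-submodule … for all but finitely many height-one primes").
[cite: Howard2004HeegnerKolyvagin, proof of Thm. 2.2.10 (Σ_Λ; 𝔮 = T^m + p)] -/
theorem forall_smul_ne_zero_of_ne_zero' (hγ : κ.IsTopGenerator γ)
    (hE : ∀ P : V.toAffine.Point, p • P = 0 → P = 0) {s : D.S} (hs : s ≠ 0) :
    ∀ d : IwasawaAlgebra p, d ≠ 0 → d • s ≠ 0 :=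
  fun _ hd h ↦ hs (D.eq_zero_of_smul_eq_zero hγ hE hd h)

/-- **A non-zero cyclic submodule `Λ ∙ s` of `𝔖_p(K_∞)` is free of rank one** (`E(K)[p] = 0`, `γ` a
topological generator): `Λ ≃ Λ ∙ s` by `LinearEquiv.toSpanNonzeroSingleton` for the non-torsion `s`. With
`HeegnerStabilizedModuleCyclicProofs` (`stabilizedHeegnerModule D C = Λ ∙ κ_∞`) this is the tree's form of
"`Λκ_∞(C)` is free of rank one", now WITHOUT a torsion-freeness hypothesis.
[cite: Howard2004HeegnerKolyvagin, Thm. 3.3.7 / Thm. B (a) (the Heegner module is free of rank one)] -/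
theorem free_finrank_span_singleton_eq_one (hγ : κ.IsTopGenerator γ)
    (hE : ∀ P : V.toAffine.Point, p • P = 0 → P = 0) {s : D.S} (hs : s ≠ 0) :
    Module.Free (IwasawaAlgebra p) (Submodule.span (IwasawaAlgebra p) {s}) ∧
      Module.finrank (IwasawaAlgebra p) (Submodule.span (IwasawaAlgebra p) {s}) = 1 := by
  haveI := D.noZeroSMulDivisors_of_noPTorsion hγ hE
  let e : IwasawaAlgebra p ≃ₗ[IwasawaAlgebra p] Submodule.span (IwasawaAlgebra p) {s} :=
    LinearEquiv.toSpanNonzeroSingleton (IwasawaAlgebra p) D.S s hs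
  exact ⟨Module.Free.of_equiv e, by rw [← e.finrank_eq, Module.finrank_self]⟩

end WeierstrassCurve.LambdaAdicSelmerData

end
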